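import Literature.Barriers.NavierStokesRegularity.NavierStokesInequalityCantorLevelData
import Literature.Barriers.NavierStokesRegularity.NavierStokesInequalityCantorLevelH
import Literature.Barriers.NavierStokesRegularity.NavierStokesInequalityCantorUniformBounds
import Literature.MeasureTheory.Hausdorff.SelfSimilarCodeWords
import Literature.Analysis.FluidPDE.HarmonicMeanValue
import Literature.Barriers.NavierStokesRegularity.NavierStokesInequalityNearlyOneDimSingularSetAssembly
import HarnessLib

/-!
# Fact D′ discharged: every Cantor arrangement carries level data (Ożański 2017, Proposition 16)

Barrier catalogue support file for `NavierStokesRegularity` (D-0021): the DISCHARGE of fact D′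
`Literature.Barriers.NavierStokesRegularity.NSICantorBlock_of_arrangement` of
`NavierStokesInequalityCantorArrangement` — W. S. Ożański, arXiv:1709.00602v4, §6.2 ((6.8)–(6.12))
and **Proposition 16**, proved in §6.3 (Steps 1–3) with the new oscillatory processes of
**Theorem 17** (§6.4); V. Scheffer, Comm. Math. Phys. 110 (1987), **Lemma 5.5** (the fields
`v^Z, q^Z` of the configurations (5.26)–(5.33), from the oscillatory process of Lemma 3.1 and the
construction of Lemma 3.2).

The proof is assembled from the tree's PROVED ingredients, following the printed argument:

* (6.8)–(6.12) — `IsNSICantorArrangement.exists_hProfileData` (`NavierStokesInequalityCantorLevelH`):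
  the profiles `h_{1,t}, h_{2,t}` of Lemma 4.1 with the Cantor gain for every similarity `Γ_n`;
* Step 1 — `IsQData.isCantorQData_level`, `isNSIStructureFamily_level`
  (`NavierStokesInequalityCantorLevelData`): the `Mʲ` pairwise disjoint axial translates of the
  pair of structures, at the positions `levelShift τ X z m`, `m : Fin j → Fin M`
  (`IsNSICantorArrangement.disjoint_translate`, from `CantorDust.disjoint_image_word`);
* Theorem 17 — `exists_isCantorOscFamily` (`NavierStokesInequalityCantorConvergence`, on the
  PROVED `Scheffer.exists_cantorOscillatoryProcesses`);
* Steps 2–3 — `IsCantorQData.exists_cantorProfileData` (`NavierStokesInequalityCantorProfilesQ`: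
  the profiles `q^{𝔪,k}_{i,t}` of (6.20), (6.21)–(6.22), Cases 1–2 in planar form) and the composite
  field (6.23) with (6.24)–(6.26) (`NavierStokesInequalityCantorProfileField`: kinematics, the
  pressure of the disjointly supported sum, transport, viscosity, energy, dissipation);
* the `j`-independence of `θ`, `ν₀`, `𝒞` — `IsNSIStructure.exists_uniform_swirl_bounds`
  (`NavierStokesInequalityCantorUniformBounds`): the bounds "`|v| ≤ 𝒞`", "`|∇v| ≤ 𝒞`" of Step 3 (iv)
  and the viscosity threshold (6.26), uniform over all profiles `C²`-close to `h_t`, carried to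
  each copy by the covariance of `u[v,f]`, `∇`, `Δ` under axial translations.

With fact C′ discharged (`NSICantorArrangementExists_holds`, `NavierStokesInequalityCantorArrangementHolds`)
and the switching discharged (`NSICantorSwitching_holds`), this closes, through the accepted
assemblies `nsiCantorBlockExists_of_block_of_arrangement` and
`navierStokesInequalityNearlyOneDimSingularSet_of_block_of_arrangement`
(`NavierStokesInequalityNearlyOneDimSingularSetAssembly`), fact B′ `NSICantorBlockExists`
(`NSICantorBlockExists_holds`) and the barrier fact itself, Scheffer's 1987 theorem
`NavierStokesInequalityNearlyOneDimSingularSet` (`NavierStokesInequalityNearlyOneDimSingularSet_holds`).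

## References

* W. S. Ożański, *On weak solutions to the Navier–Stokes inequality with internal
  singularities*, arXiv:1709.00602v4, §6.2 ((6.8)–(6.12), Prop. 16), §6.3 (Steps 1–3,
  (6.19)–(6.26)), §6.4 (Theorem 17). [`Ozanski2017NSISingular`]
* V. Scheffer, *Nearly one dimensional singularities of solutions to the Navier–Stokes
  inequality*, Comm. Math. Phys. 110 (1987), 525–551: Lemmas 3.1–3.2, Lemma 5.5, Lemmas 5.6–5.8.
  [`Scheffer1987`]
-/

noncomputable section

open MeasureTheory Set Function Filter Topology TopologicalSpace Metric
open scoped ENNReal NNReal InnerProductSpace RealInnerProductSpace ContDiff Laplacian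

namespace Literature.Barriers.NavierStokesRegularity

open Literature.Analysis.FluidPDE Literature.MeasureTheory.Hausdorff

/-! ### Translations: swirl fields and structures of the copies -/

variable {A : Type*} [Fintype A]

omit [Fintype A] in
/-- **The swirl field of the copy `m` is the translate of a base swirl field**: with the re-based
profile `Q' = Q(· + (0, c m))`, `u[b V_i^m, Q] = u[b V_i, Q'](· - c m x̂)`.
[cite: Ozanski2017NSISingular, §6.3 Step 1] -/
theorem swirlField_level_eq (V : Fin 2 → ℝ × ℝ → ℝ × ℝ) (c : A → ℝ) (i : Fin 2) (m : A) (b : ℝ)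
    (Q : ℝ × ℝ → ℝ) :
    swirlField (b • levelFun V c i m) Q = fun x : EuclideanSpace ℝ (Fin 3) =>
      swirlField (b • V i) (fun q => Q (q + (0, c m))) ((-c m) • eZ + x) := by
  have h := swirlField_comp_add_axial' (b • V i) (fun q => Q (q + (0, c m))) (-c m)
  have e1 : (fun q : ℝ × ℝ => (b • V i) (q + (0, -c m))) = b • levelFun V c i m := by
    funext q; simp [levelFun]
  have e2 : (fun q : ℝ × ℝ => (fun q => Q (q + (0, c m))) (q + (0, -c m))) = Q := by
    funext q; simp only; congr 1; ext <;> simp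
  rw [e1, e2] at h
  rw [h]
  funext x
  rw [one_smul]

omit [Fintype A] in
/-- **Re-basing a structure from the copy `m`**: a structure `(b V_i^m, Q, ψ_i^m)` on `U_i^m` gives
the structure `(b V_i, Q(· + (0, c m)), ψ_i)` on `U_i`. [cite: Ozanski2017NSISingular, §6.3 Step 1] -/
theorem IsNSIStructure.of_level {U : Fin 2 → Set (ℝ × ℝ)} {V : Fin 2 → ℝ × ℝ → ℝ × ℝ}
    {ψ : Fin 2 → ℝ × ℝ → ℝ} {c : A → ℝ} {i : Fin 2} {m : A} {b : ℝ} {Q : ℝ × ℝ → ℝ}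
    (h : IsNSIStructure (levelSet U c i m) (b • levelFun V c i m) Q (levelFun ψ c i m)) :
    IsNSIStructure (U i) (b • V i) (fun q => Q (q + (0, c m))) (ψ i) := by
  have h' := h.comp_add_axial (c m)
  have e : ∀ q : ℝ × ℝ, q + (0, c m) + (0, -c m) = q := fun q => by ext <;> simp
  have hU : (fun q : ℝ × ℝ => q + (0, c m)) ⁻¹' levelSet U c i m = U i := by
    ext q; simp only [mem_preimage, mem_levelSet, e]
  have hV : (fun q : ℝ × ℝ => (b • levelFun V c i m) (q + (0, c m))) = b • V i := by
    funext q; simp only [Pi.smul_apply, levelFun_apply, e]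
  have hψ : (fun q : ℝ × ℝ => levelFun ψ c i m (q + (0, c m))) = ψ i := by
    funext q; simp only [levelFun_apply, e]
  rw [hU, hV, hψ] at h'
  exact h'

/-! ### Disjointness of the `Mʲ` axial translates of `G` (Ożański 2017, §6.1 and (6.22)) -/

section Translates

variable {U₁ U₂ : Set (ℝ × ℝ)} {v₁ : ℝ × ℝ → ℝ × ℝ} {f₁ φ₁ : ℝ × ℝ → ℝ} {v₂ : ℝ × ℝ → ℝ × ℝ}
  {f₂ φ₂ : ℝ × ℝ → ℝ} {T τ : ℝ} {M : ℕ} {X : ℝ} {z : EuclideanSpace ℝ (Fin 3)}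

/-- **The `Mʲ` translates `G + levelShift(m) x̂_axis` of `G` are pairwise disjoint**, because the
pieces `Γ_m(G) = c_j + τʲ(G + levelShift(m) x̂)` are (Ożański §6.1: "`Γ_m(G) ∩ Γ_{m̃}(G) = ∅` for
`m ≠ m̃`"; §6.3 Step 1, (6.22)). [cite: Ozanski2017NSISingular, §6.1 and §6.3 (6.22)] -/
theorem IsNSICantorArrangement.disjoint_translate
    (hA : IsNSICantorArrangement U₁ U₂ v₁ f₁ φ₁ v₂ f₂ φ₂ T τ M X z) {j : ℕ} {m m' : Fin j → Fin M}
    (hne : m ≠ m') :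
    Disjoint ((fun y : EuclideanSpace ℝ (Fin 3) => y + levelShift τ X z m • eZ) ''
        revolve (closure U₁ ∪ closure U₂))
      ((fun y : EuclideanSpace ℝ (Fin 3) => y + levelShift τ X z m' • eZ) ''
        revolve (closure U₁ ∪ closure U₂)) := by
  have hτ : τ ≠ 0 := hA.τ_pos.ne'
  have hw := CantorDust.disjoint_image_word hτ hA.mapsTo hA.disjoint_image hne
  rw [Set.disjoint_left] at hw ⊢
  rintro x ⟨y, hy, rfl⟩ ⟨y', hy', hyy'⟩
  -- `c_j + τʲ x` lies in both `Γ_m(G)` and `Γ_{m'}(G)`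
  have h1 : levelCenter τ z j + τ ^ j • (y + levelShift τ X z m • eZ) ∈
      CantorDust.word τ (cantorTranslate X z M) m '' revolve (closure U₁ ∪ closure U₂) :=
    ⟨y, hy, (word_cantorTranslate_eq hτ X z m y).trans rfl⟩
  have h2 : levelCenter τ z j + τ ^ j • (y + levelShift τ X z m • eZ) ∈
      CantorDust.word τ (cantorTranslate X z M) m' '' revolve (closure U₁ ∪ closure U₂) := by
    refine ⟨y', hy', ?_⟩
    rw [word_cantorTranslate_eq hτ X z m' y']
    show levelCenter τ z j + τ ^ j • (y' + levelShift τ X z m' • EuclideanSpace.single 2 1) =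
      levelCenter τ z j + τ ^ j • (y + levelShift τ X z m • eZ)
    have hyy'' : y' + levelShift τ X z m' • eZ = y + levelShift τ X z m • eZ := hyy'
    rw [show (EuclideanSpace.single 2 1 : EuclideanSpace ℝ (Fin 3)) = eZ from rfl, hyy'']
  exact hw h1 h2

end Translates

/-! ### One generation: the composite field on the translated pairs (Proposition 16) -/

section Level

variable {U : Fin 2 → Set (ℝ × ℝ)} {V : Fin 2 → ℝ × ℝ → ℝ × ℝ} {f φ ψ : Fin 2 → ℝ × ℝ → ℝ}
  {H : Fin 2 → ℝ → ℝ × ℝ → ℝ} {T δ : ℝ} {κ : ℝ → ℝ} {a₀ : ℕ → Fin 2 → ℝ → ℝ}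

/-- `H_{0,s}(q) H_{1,s}(q) = 0`: the two profiles have disjoint supports. [folklore] -/
theorem IsQData.H_mul_H_eq_zero (hQ : IsQData U V f φ ψ H T δ κ a₀)
    (hd : Disjoint (closure (U 0)) (closure (U 1))) (s : ℝ) (q : ℝ × ℝ) :
    H 0 s q * H 1 s q = 0 := by
  by_cases hq : q ∈ closure (U 0)
  · rw [hQ.H_eq_zero 1 s (Set.disjoint_left.1 hd hq), mul_zero]
  · rw [hQ.H_eq_zero 0 s hq, zero_mul]

set_option maxHeartbeats 1600000 in
/-- **Proposition 16 for one generation, on the translated pairs.** Given the data of Lemma 4.1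
for a pair of structures with disjoint closures (`IsQData`), finitely many axial positions `c`
whose translates of `G = R(Ū₁ ∪ Ū₂)` are pairwise disjoint, and the uniform constants `ε₀, Λ` of
`IsNSIStructure.exists_uniform_swirl_bounds` for both structures, there is — for any closeness
`θ' > 0` — a field `W ∈ C^∞` on an open slab around `[0,T]` with: `div W(s) = 0`,
`supp W(s) ⊆ ⋃_m (G + c m x̂)`, `|W(y + c m x̂, 0)| = (f₁ + f₂)(R⁻¹y)` and
`||W(y + c m x̂, s)|² - (h_{1,s} + h_{2,s})(R⁻¹y)²| ≤ θ'` (`y ∈ G`), the pointwise Navier–Stokes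
inequality for all `ν ∈ [0, (δ/4)/(2Λ+1)]`, `∫|W(s)|² ≤ Λ·card A·(|R(Ū₁)| + |R(Ū₂)|)` and
`∫₀ᵀ∫|∇W|² ≤ Λ·card A·(|R(Ū₁)| + |R(Ū₂)|)·T` (Ożański §6.3: (6.23) with Steps 2–3; Theorem 17).
[cite: Ozanski2017NSISingular, Prop. 16 and §6.3] [cite: Scheffer1987, Lemma 5.5] -/
theorem IsQData.exists_levelField (hQ : IsQData U V f φ ψ H T δ κ a₀)
    (hd : Disjoint (closure (U 0)) (closure (U 1))) {c : A → ℝ}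
    (hdisj : ∀ m m' : A, m ≠ m' →
      Disjoint ((fun y : EuclideanSpace ℝ (Fin 3) => y + c m • eZ) '' revolve (closure (U 0) ∪ closure (U 1)))
        ((fun y : EuclideanSpace ℝ (Fin 3) => y + c m' • eZ) '' revolve (closure (U 0) ∪ closure (U 1))))
    {ε₀ Λ : ℝ} (hε₀ : 0 < ε₀) (hΛ : 0 ≤ Λ)
    (hB : ∀ i : Fin 2, ∀ t ∈ Icc (0 : ℝ) T, ∀ b : ℝ, |b| ≤ 1 → ∀ (Q χ : ℝ × ℝ → ℝ),
      IsNSIStructure (U i) (b • V i) Q χ → (∀ q, φ i q < 1 → Q q = H i t q) →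
      (∀ q, |Q q ^ 2 - H i t q ^ 2| ≤ ε₀) →
      (∀ q, ‖fderiv ℝ (fun y => Q y ^ 2 - H i t y ^ 2) q‖ ≤ ε₀) →
      (∀ q, ‖fderiv ℝ (fderiv ℝ fun y => Q y ^ 2 - H i t y ^ 2) q‖ ≤ ε₀) →
      (∀ q, Q q ^ 2 ≤ Λ) ∧ ∀ x : EuclideanSpace ℝ (Fin 3),
        frobeniusNormSq (fderiv ℝ (swirlField (b • V i) Q) x) ≤ Λ ∧
          -Λ ≤ ⟪swirlField (b • V i) Q x, (Δ (swirlField (b • V i) Q)) x⟫)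
    {θ' : ℝ} (hθ' : 0 < θ') :
    ∃ W : ℝ → EuclideanSpace ℝ (Fin 3) → EuclideanSpace ℝ (Fin 3),
      (∃ η : ℝ, 0 < η ∧ IsSmoothSpaceTimeOn (Ioo (-η) (T + η)) W) ∧
      (∀ s ∈ Icc (0 : ℝ) T, VectorCalculus.IsDivFree (W s)) ∧
      (∀ s ∈ Icc (0 : ℝ) T, tsupport (W s) ⊆
        ⋃ m : A, (fun y : EuclideanSpace ℝ (Fin 3) => y + c m • eZ) '' revolve (closure (U 0) ∪ closure (U 1))) ∧
      (∀ y ∈ revolve (closure (U 0) ∪ closure (U 1)), ∀ m : A,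
        ‖W 0 (y + c m • eZ)‖ = f 0 (meridian y) + f 1 (meridian y)) ∧
      (∀ s ∈ Icc (0 : ℝ) T, ∀ y ∈ revolve (closure (U 0) ∪ closure (U 1)), ∀ m : A,
        |‖W s (y + c m • eZ)‖ ^ 2 - (H 0 s (meridian y) + H 1 s (meridian y)) ^ 2| ≤ θ') ∧
      (∀ ν ∈ Icc (0 : ℝ) (δ / 4 / (2 * Λ + 1)), ∀ s ∈ Icc (0 : ℝ) T, ∀ x : EuclideanSpace ℝ (Fin 3),
        timeDeriv (fun r y => ‖W r y‖ ^ 2) s x ≤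
          -⟪W s x, gradient (fun y => ‖W s y‖ ^ 2 + 2 * normalisedPressure (W s) y) x⟫ +
            2 * ν * ⟪W s x, (Δ (W s)) x⟫) ∧
      (∀ s ∈ Icc (0 : ℝ) T, ∫⁻ x, ‖W s x‖ₑ ^ 2 ≤ ENNReal.ofReal Λ *
        ((Fintype.card A : ℝ≥0∞) * (volume (revolve (closure (U 0))) + volume (revolve (closure (U 1)))))) ∧
      ((∫⁻ s in Icc (0 : ℝ) T, ∫⁻ x, ENNReal.ofReal (frobeniusNormSq (fderiv ℝ (W s) x))) ≤
        ENNReal.ofReal Λ * ((Fintype.card A : ℝ≥0∞) *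
          (volume (revolve (closure (U 0))) + volume (revolve (closure (U 1))))) * ENNReal.ofReal T) := by
  have hT := hQ.T_pos
  -- Step 1: the translated pairs and their data; Theorem 17; Steps 2–3
  have hF : IsNSIStructureFamily (levelSet U c) (levelFun V c) (levelFun f c) (levelFun φ c) :=
    isNSIStructureFamily_level hQ.isNSIStructure hd hdisj
  obtain ⟨a, ha⟩ := exists_isCantorOscFamily A hT
  have hQj := hQ.isCantorQData_level c ha
  set ε' : ℝ := min (θ' / 2) ε₀ with hε'
  have hε'0 : 0 < ε' := lt_min (by positivity) hε₀
  have hε'θ : ε' ≤ θ' / 2 := min_le_left _ _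
  have hε'ε : ε' ≤ ε₀ := min_le_right _ _
  obtain ⟨η, k, hP⟩ := hQj.exists_cantorProfileData hε'0
  set Qf := cqProf (levelFun f c) (levelFun φ c) δ κ a (levelFun V c) (levelFunT H c) k with hQf
  set W : ℝ → EuclideanSpace ℝ (Fin 3) → EuclideanSpace ℝ (Fin 3) :=
    cprofileField (levelFun V c) (a k) Qf with hW
  have hK : closure (U 0) ∪ closure (U 1) ⊆ halfPlane :=
    union_subset (hQ.isNSIStructure 0).closure_subset (hQ.isNSIStructure 1).closure_subset
  have hIcc : Icc (0 : ℝ) T ⊆ Ioo (-η) (T + η) := hP.Icc_subset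
  -- the structures `(b V_i^m, Q_i^m(t), ψ_i^m)` for `t ∈ [0,T]`
  have hposS : ∀ i m, ∀ t ∈ Ioo (-η) (T + η), ∀ x ∈ levelSet U c i m,
      (levelFun V c i m x).1 ^ 2 + (levelFun V c i m x).2 ^ 2 <
        cqRad (levelFun f c) (levelFun φ c) δ κ a (levelFun V c) (levelFunT H c) k i m t x := by
    intro i m t ht x hx
    have h1 := hP.sq_lt i m t ht x hx
    have h0 : 0 < Qf i m t x ^ 2 := lt_of_le_of_lt (by positivity) h1
    have hrad : 0 ≤ cqRad (levelFun f c) (levelFun φ c) δ κ a (levelFun V c) (levelFunT H c) k i m t x := by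
      by_contra hneg
      have : Qf i m t x = 0 := by
        simp only [hQf, cqProf]; exact Real.sqrt_eq_zero'.2 (le_of_lt (not_le.1 hneg))
      rw [this] at h0; simp at h0
    rwa [hQf, IsCantorQData.cqProf_sq hrad] at h1
  have hstrQ : ∀ i m, ∀ t ∈ Icc (0 : ℝ) T, ∀ b : ℝ, |b| ≤ 1 →
      IsNSIStructure (levelSet U c i m) (b • levelFun V c i m) (Qf i m t) (levelFun ψ c i m) := by
    intro i m t ht b hb
    have hκt : κ t ∈ Icc (-1 : ℝ) (T + 1) := by
      rw [hQj.κ_eq t ht]; exact ⟨by linarith [ht.1], by linarith [ht.2]⟩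
    exact (hQj.crit_cqProf (k := k) i m (hposS i m) (hIcc ht) hκt).1 b hb
  -- the uniform bounds, carried to each copy
  have hbase : ∀ i m, ∀ t ∈ Icc (0 : ℝ) T,
      (∀ q, Qf i m t q ^ 2 ≤ Λ) ∧ ∀ x : EuclideanSpace ℝ (Fin 3),
        frobeniusNormSq (fderiv ℝ (swirlField (a k i m t • levelFun V c i m) (Qf i m t)) x) ≤ Λ ∧
        -Λ ≤ ⟪swirlField (a k i m t • levelFun V c i m) (Qf i m t) x,
          (Δ (swirlField (a k i m t • levelFun V c i m) (Qf i m t))) x⟫ := by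
    intro i m t ht
    set b := a k i m t with hb
    have hb1 : |b| ≤ 1 := ha.abs_le k i m t
    set Q' : ℝ × ℝ → ℝ := fun q => Qf i m t (q + (0, c m)) with hQ'
    have e : ∀ q : ℝ × ℝ, q + (0, c m) + (0, -c m) = q := fun q => by ext <;> simp
    have hstr' : IsNSIStructure (U i) (b • V i) Q' (ψ i) := (hstrQ i m t ht b hb1).of_level
    have heqH : ∀ q, φ i q < 1 → Q' q = H i t q := fun q hq => by
      have h1 := hP.eq_H i m t (q + (0, c m)) (by simpa only [levelFun_apply, e] using hq)
      simpa only [hQ', levelFunT_apply, e] using h1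
    have eD : (fun y => Q' y ^ 2 - H i t y ^ 2) =
        fun y => (fun y' => Qf i m t y' ^ 2 - levelFunT H c i m t y' ^ 2) (y + (0, c m)) := by
      funext y; simp only [hQ', levelFunT_apply, e]
    have h0 : ∀ q, |Q' q ^ 2 - H i t q ^ 2| ≤ ε₀ := fun q => by
      have := hP.close₀ i m t ht (q + (0, c m))
      simp only [levelFunT_apply, e] at this
      exact this.trans hε'ε
    have h1 : ∀ q, ‖fderiv ℝ (fun y => Q' y ^ 2 - H i t y ^ 2) q‖ ≤ ε₀ := fun q => by
      rw [eD, fderiv_comp_add_right (f := fun y' => Qf i m t y' ^ 2 - levelFunT H c i m t y' ^ 2)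
        ((0 : ℝ), c m)]
      exact (hP.close₁ i m t ht _).trans hε'ε
    have h2 : ∀ q, ‖fderiv ℝ (fderiv ℝ fun y => Q' y ^ 2 - H i t y ^ 2) q‖ ≤ ε₀ := fun q => by
      have hfd : fderiv ℝ (fun y => (fun y' => Qf i m t y' ^ 2 - levelFunT H c i m t y' ^ 2) (y + ((0 : ℝ), c m))) =
          fun y => fderiv ℝ (fun y' => Qf i m t y' ^ 2 - levelFunT H c i m t y' ^ 2) (y + ((0 : ℝ), c m)) :=
        funext fun y => fderiv_comp_add_right
          (f := fun y' => Qf i m t y' ^ 2 - levelFunT H c i m t y' ^ 2) ((0 : ℝ), c m)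
      rw [eD, hfd, fderiv_comp_add_right
        (f := fderiv ℝ fun y' => Qf i m t y' ^ 2 - levelFunT H c i m t y' ^ 2) ((0 : ℝ), c m)]
      exact (hP.close₂ i m t ht _).trans hε'ε
    obtain ⟨hsq, hpt⟩ := hB i t ht b hb1 Q' (ψ i) hstr' heqH h0 h1 h2
    have esw := swirlField_level_eq V c i m b (Qf i m t)
    refine ⟨fun q => ?_, fun x => ⟨?_, ?_⟩⟩
    · have := hsq (q + (0, -c m))
      have e' : q + (0, -c m) + (0, c m) = q := by ext <;> simp
      simpa only [hQ', e'] using this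
    · rw [esw, fderiv_comp_add_left]
      exact (hpt _).1
    · rw [esw, laplacian_comp_const_add]
      exact (hpt _).2
  -- the lower bound `W·ΔW ≥ -Λ`
  have hlow : ∀ t ∈ Icc (0 : ℝ) T, ∀ x : EuclideanSpace ℝ (Fin 3), -Λ ≤ ⟪W t x, (Δ (W t)) x⟫ := by
    intro t ht x
    by_cases hx : ∃ p : Fin 2 × A, meridian x ∈ closure (levelSet U c p.1 p.2)
    · obtain ⟨p, hp⟩ := hx
      rw [hW, hP.inner_laplacian_cprofileField_eq hF (hIcc ht) p hp]
      exact ((hbase p.1 p.2 t ht).2 x).2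
    · push Not at hx
      rw [hW, hP.inner_laplacian_cprofileField_eq_zero hF (hIcc ht) hx]
      linarith
  -- volumes of the copies
  have hvol : ∑ p : Fin 2 × A, volume (revolve (closure (levelSet U c p.1 p.2))) =
      (Fintype.card A : ℝ≥0∞) * (volume (revolve (closure (U 0))) + volume (revolve (closure (U 1)))) := by
    simp only [volume_revolve_closure_levelSet]
    rw [Fintype.sum_prod_type]
    simp only [Finset.sum_const, Finset.card_univ, nsmul_eq_mul, Fin.sum_univ_two]
    ring
  have hHz : ∀ i m t, ∀ q ∉ closure (levelSet U c i m), levelFunT H c i m t q = 0 := by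
    intro i m t q hq
    rw [closure_levelSet] at hq
    exact hQ.H_eq_zero i t hq
  refine ⟨W, ⟨η, hP.η_pos, hP.isSmoothSpaceTimeOn_cprofileField hF⟩,
    fun s hs => hP.isDivFree_cprofileField hF (hIcc hs), fun s hs => ?_, fun y hy m => ?_,
    fun s hs y hy m => ?_, fun ν hν s hs x => hP.nsi_cprofileField hF hΛ hlow hν hs x,
    fun s hs => ?_, ?_⟩
  · -- supports
    refine (hP.tsupport_cprofileField_subset hF (hIcc hs)).trans (iUnion_subset fun p => ?_)
    rw [revolve_closure_levelSet]
    refine (image_mono ?_).trans (subset_iUnion (fun m' : A =>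
      (fun y : EuclideanSpace ℝ (Fin 3) => y + c m' • eZ) '' revolve (closure (U 0) ∪ closure (U 1))) p.2)
    intro y hy
    rw [mem_revolve] at hy ⊢
    obtain ⟨i, m'⟩ := p
    fin_cases i
    · exact Or.inl hy
    · exact Or.inr hy
  · -- `|W(y + c m x̂, 0)| = (f₁ + f₂)(R⁻¹y)`
    rw [hW, hP.norm_cprofileField_zero hF hT]
    simp only [levelFun_apply, meridian_add_smul_eZ]
    have hf0 : ∀ i, ∀ q ∉ closure (U i), f i q = 0 := fun i q hq => (hQ.isNSIStructure i).f_eq_zero hq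
    exact sum_levelFun_translate hK hdisj hf0 hy m
  · -- closeness to `(h₁ + h₂)²`
    have h1 := hP.abs_norm_sq_sub_le hF hHz hs (y + c m • eZ)
    rw [hW]
    have hsum : ∑ p : Fin 2 × A, levelFunT H c p.1 p.2 s (meridian (y + c m • eZ)) ^ 2 =
        (H 0 s (meridian y) + H 1 s (meridian y)) ^ 2 := by
      simp only [levelFunT_apply, meridian_add_smul_eZ]
      have hg : ∀ i, ∀ q ∉ closure (U i), (fun i q => H i s q ^ 2) i q = 0 := fun i q hq => by
        simp only [hQ.H_eq_zero i s hq]; ring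
      have := sum_levelFun_translate (g := fun i q => H i s q ^ 2) hK hdisj hg hy m
      rw [this]
      have hz := hQ.H_mul_H_eq_zero hd s (meridian y)
      nlinarith [hz]
    rw [hsum] at h1
    exact h1.trans (hε'θ.trans (by linarith))
  · -- energy
    have hS : ∀ i m q, Qf i m s q ^ 2 ≤ Λ := fun i m q => (hbase i m s hs).1 q
    calc ∫⁻ x, ‖W s x‖ₑ ^ 2 ≤ ENNReal.ofReal Λ * ∑ p : Fin 2 × A, volume (revolve (closure (levelSet U c p.1 p.2))) :=
          hP.lintegral_enorm_sq_cprofileField_le hF (hIcc hs) hS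
      _ = _ := by rw [hvol]
  · -- dissipation
    have hpt : ∀ s ∈ Icc (0 : ℝ) T,
        ∫⁻ x, ENNReal.ofReal (frobeniusNormSq (fderiv ℝ (W s) x)) ≤
          ENNReal.ofReal Λ * ((Fintype.card A : ℝ≥0∞) *
            (volume (revolve (closure (U 0))) + volume (revolve (closure (U 1))))) := by
      intro s hs
      have hΛ' : ∀ (p : Fin 2 × A) (x : EuclideanSpace ℝ (Fin 3)),
          frobeniusNormSq (fderiv ℝ (swirlField (a k p.1 p.2 s • levelFun V c p.1 p.2) (Qf p.1 p.2 s)) x) ≤ Λ :=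
        fun p x => ((hbase p.1 p.2 s hs).2 x).1
      calc _ ≤ ENNReal.ofReal Λ * ∑ p : Fin 2 × A, volume (revolve (closure (levelSet U c p.1 p.2))) :=
            hP.lintegral_frobenius_cprofileField_le hF (hIcc hs) hΛ'
        _ = _ := by rw [hvol]
    calc _ ≤ ∫⁻ s in Icc (0 : ℝ) T, ENNReal.ofReal Λ * ((Fintype.card A : ℝ≥0∞) *
            (volume (revolve (closure (U 0))) + volume (revolve (closure (U 1))))) :=
          setLIntegral_mono' measurableSet_Icc hpt
      _ = _ := by rw [setLIntegral_const, Real.volume_Icc, sub_zero]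

end Level

/-! ### Fact D′ -/

section Main

variable {U₁ U₂ : Set (ℝ × ℝ)} {v₁ : ℝ × ℝ → ℝ × ℝ} {f₁ φ₁ : ℝ × ℝ → ℝ} {v₂ : ℝ × ℝ → ℝ × ℝ}
  {f₂ φ₂ : ℝ × ℝ → ℝ} {T τ : ℝ} {M : ℕ} {X : ℝ} {z : EuclideanSpace ℝ (Fin 3)}

/-- Uniform constants for BOTH structures of the pair (the smaller `ε₀`, the larger `Λ`). [folklore] -/
theorem IsQData.exists_uniform_swirl_bounds_pair {U : Fin 2 → Set (ℝ × ℝ)}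
    {V : Fin 2 → ℝ × ℝ → ℝ × ℝ} {f φ ψ : Fin 2 → ℝ × ℝ → ℝ} {H : Fin 2 → ℝ → ℝ × ℝ → ℝ} {T δ : ℝ}
    {κ : ℝ → ℝ} {a₀ : ℕ → Fin 2 → ℝ → ℝ} (hQ : IsQData U V f φ ψ H T δ κ a₀) :
    ∃ ε₀ > 0, ∃ Λ : ℝ, 0 ≤ Λ ∧ ∀ i : Fin 2, ∀ t ∈ Icc (0 : ℝ) T, ∀ b : ℝ, |b| ≤ 1 →
      ∀ (Q χ : ℝ × ℝ → ℝ), IsNSIStructure (U i) (b • V i) Q χ →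
      (∀ q, φ i q < 1 → Q q = H i t q) →
      (∀ q, |Q q ^ 2 - H i t q ^ 2| ≤ ε₀) →
      (∀ q, ‖fderiv ℝ (fun y => Q y ^ 2 - H i t y ^ 2) q‖ ≤ ε₀) →
      (∀ q, ‖fderiv ℝ (fderiv ℝ fun y => Q y ^ 2 - H i t y ^ 2) q‖ ≤ ε₀) →
      (∀ q, Q q ^ 2 ≤ Λ) ∧ ∀ x : EuclideanSpace ℝ (Fin 3),
        frobeniusNormSq (fderiv ℝ (swirlField (b • V i) Q) x) ≤ Λ ∧
          -Λ ≤ ⟪swirlField (b • V i) Q x, (Δ (swirlField (b • V i) Q)) x⟫ := by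
  have key : ∀ i : Fin 2, ∃ ε₀ > 0, ∃ Λ : ℝ, 0 ≤ Λ ∧ ∀ t ∈ Icc (0 : ℝ) T, ∀ b : ℝ, |b| ≤ 1 →
      ∀ (Q χ : ℝ × ℝ → ℝ), IsNSIStructure (U i) (b • V i) Q χ →
      (∀ q, φ i q < 1 → Q q = H i t q) →
      (∀ q, |Q q ^ 2 - H i t q ^ 2| ≤ ε₀) →
      (∀ q, ‖fderiv ℝ (fun y => Q y ^ 2 - H i t y ^ 2) q‖ ≤ ε₀) →
      (∀ q, ‖fderiv ℝ (fderiv ℝ fun y => Q y ^ 2 - H i t y ^ 2) q‖ ≤ ε₀) →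
      (∀ q, Q q ^ 2 ≤ Λ) ∧ ∀ x : EuclideanSpace ℝ (Fin 3),
        frobeniusNormSq (fderiv ℝ (swirlField (b • V i) Q) x) ≤ Λ ∧
          -Λ ≤ ⟪swirlField (b • V i) Q x, (Δ (swirlField (b • V i) Q)) x⟫ := fun i =>
    (hQ.isNSIStructure i).exists_uniform_swirl_bounds (hQ.H_smooth i) (fun t b hb => hQ.H_str i t b hb) T
  obtain ⟨ε₁, hε₁, Λ₁, hΛ₁, h₁⟩ := key 0
  obtain ⟨ε₂, hε₂, Λ₂, hΛ₂, h₂⟩ := key 1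
  refine ⟨min ε₁ ε₂, lt_min hε₁ hε₂, max Λ₁ Λ₂, le_max_of_le_left hΛ₁, ?_⟩
  intro i t ht b hb Q χ hS hH h0 h1 h2
  fin_cases i
  · obtain ⟨ha, hb'⟩ := h₁ t ht b hb Q χ hS hH (fun q => (h0 q).trans (min_le_left _ _))
      (fun q => (h1 q).trans (min_le_left _ _)) (fun q => (h2 q).trans (min_le_left _ _))
    exact ⟨fun q => (ha q).trans (le_max_left _ _), fun x => ⟨((hb' x).1).trans (le_max_left _ _),
      neg_le_neg_iff.2 (le_max_left _ _) |>.trans (hb' x).2⟩⟩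
  · obtain ⟨ha, hb'⟩ := h₂ t ht b hb Q χ hS hH (fun q => (h0 q).trans (min_le_right _ _))
      (fun q => (h1 q).trans (min_le_right _ _)) (fun q => (h2 q).trans (min_le_right _ _))
    exact ⟨fun q => (ha q).trans (le_max_right _ _), fun x => ⟨((hb' x).1).trans (le_max_right _ _),
      neg_le_neg_iff.2 (le_max_right _ _) |>.trans (hb' x).2⟩⟩

set_option maxHeartbeats 1600000 in
/-- **Proposition 16 / the level data of a Cantor arrangement** (Ożański 2017, §6.2 (6.8)–(6.12) and
Prop. 16, proved in §6.3–§6.4; Scheffer 1987, Lemma 5.5): every geometric arrangement for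
Theorem 14 carries `θ, ν₀, h, V` forming `IsNSICantorLevelFields`, with `h_t = h_{1,t} + h_{2,t}`
(Lemma 4.1), `θ` half the margin of (6.12), `ν₀ = (δ/4)/(2Λ + 1)` for the uniform viscous bound
`Λ`, and `V j` the composite field (6.23) on the `Mʲ` translated pairs for a good index `k(j)` of
the new oscillatory processes. [cite: Ozanski2017NSISingular, Prop. 16, §6.2–§6.4]
[cite: Scheffer1987, Lemma 5.5] -/
theorem IsNSICantorArrangement.exists_levelFields
    (hA : IsNSICantorArrangement U₁ U₂ v₁ f₁ φ₁ v₂ f₂ φ₂ T τ M X z) :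
    ∃ (θ ν₀ : ℝ) (h : ℝ → ℝ × ℝ → ℝ) (V : ℕ → ℝ → EuclideanSpace ℝ (Fin 3) → EuclideanSpace ℝ (Fin 3)),
      IsNSICantorLevelFields U₁ U₂ f₁ f₂ T τ M X z θ ν₀ h V := by
  have hA1 := hA.isNSIArrangement
  have hT := hA.T_pos
  -- (6.8)–(6.12): Lemma 4.1 with the Cantor gains
  obtain ⟨δ, κ, ψ₁, ψ₂, m₁, m₂, θ, hH, hgainC⟩ := hA.exists_hProfileData
  obtain ⟨a₀, ha₀⟩ := exists_isOscFamily hT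
  have hQ := hH.isQData hA1 ha₀
  have hd : Disjoint (closure (![U₁, U₂] 0)) (closure (![U₁, U₂] 1)) := hA.disjoint_closure
  -- the `j`-uniform constants
  obtain ⟨ε₀, hε₀, Λ, hΛ, hB⟩ := hQ.exists_uniform_swirl_bounds_pair
  set hprof : ℝ → ℝ × ℝ → ℝ := fun t q =>
    hProfile₁ f₁ φ₁ δ κ t q + hProfile₂ v₁ v₂ f₁ φ₁ f₂ φ₂ δ κ t q with hhprof
  have hθ := hH.θ_pos
  have hδ := hH.δ_pos
  -- one generation
  have hGeq : revolve (closure (![U₁, U₂] 0) ∪ closure (![U₁, U₂] 1)) = revolve (closure U₁ ∪ closure U₂) := rfl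
  have level : ∀ j : ℕ, ∃ W : ℝ → EuclideanSpace ℝ (Fin 3) → EuclideanSpace ℝ (Fin 3),
      (∃ η : ℝ, 0 < η ∧ IsSmoothSpaceTimeOn (Ioo (-η) (T + η)) W) ∧
      (∀ s ∈ Icc (0 : ℝ) T, VectorCalculus.IsDivFree (W s)) ∧
      (∀ s ∈ Icc (0 : ℝ) T, tsupport (W s) ⊆ ⋃ m : Fin j → Fin M,
        (fun y : EuclideanSpace ℝ (Fin 3) => y + levelShift τ X z m • eZ) '' revolve (closure U₁ ∪ closure U₂)) ∧
      (∀ y ∈ revolve (closure U₁ ∪ closure U₂), ∀ m : Fin j → Fin M,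
        ‖W 0 (y + levelShift τ X z m • eZ)‖ = f₁ (meridian y) + f₂ (meridian y)) ∧
      (∀ s ∈ Icc (0 : ℝ) T, ∀ y ∈ revolve (closure U₁ ∪ closure U₂), ∀ m : Fin j → Fin M,
        |‖W s (y + levelShift τ X z m • eZ)‖ ^ 2 - hprof s (meridian y) ^ 2| ≤ θ / 4) ∧
      (∀ ν ∈ Icc (0 : ℝ) (δ / 4 / (2 * Λ + 1)), ∀ s ∈ Icc (0 : ℝ) T, ∀ x : EuclideanSpace ℝ (Fin 3),
        timeDeriv (fun r y => ‖W r y‖ ^ 2) s x ≤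
          -⟪W s x, gradient (fun y => ‖W s y‖ ^ 2 + 2 * normalisedPressure (W s) y) x⟫ +
            2 * ν * ⟪W s x, (Δ (W s)) x⟫) ∧
      (∀ s ∈ Icc (0 : ℝ) T, ∫⁻ x, ‖W s x‖ₑ ^ 2 ≤ ENNReal.ofReal Λ *
        (((M : ℝ≥0∞) ^ j) * (volume (revolve (closure U₁)) + volume (revolve (closure U₂))))) ∧
      ((∫⁻ s in Icc (0 : ℝ) T, ∫⁻ x, ENNReal.ofReal (frobeniusNormSq (fderiv ℝ (W s) x))) ≤
        ENNReal.ofReal Λ * (((M : ℝ≥0∞) ^ j) *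
          (volume (revolve (closure U₁)) + volume (revolve (closure U₂)))) * ENNReal.ofReal T) := by
    intro j
    have hdisj : ∀ m m' : Fin j → Fin M, m ≠ m' →
        Disjoint ((fun y : EuclideanSpace ℝ (Fin 3) => y + levelShift τ X z m • eZ) ''
            revolve (closure (![U₁, U₂] 0) ∪ closure (![U₁, U₂] 1)))
          ((fun y : EuclideanSpace ℝ (Fin 3) => y + levelShift τ X z m' • eZ) ''
            revolve (closure (![U₁, U₂] 0) ∪ closure (![U₁, U₂] 1))) :=
      fun m m' hne => hA.disjoint_translate hne
    have hcard : (Fintype.card (Fin j → Fin M) : ℝ≥0∞) = (M : ℝ≥0∞) ^ j := by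
      rw [Fintype.card_fun, Fintype.card_fin, Fintype.card_fin]; push_cast; rfl
    obtain ⟨W, h1, h2, h3, h4, h5, h6, h7, h8⟩ := hQ.exists_levelField hd hdisj hε₀ hΛ hB
      (θ' := θ / 4) (by positivity)
    refine ⟨W, h1, h2, h3, ?_, ?_, h6, ?_, ?_⟩
    · intro y hy m
      exact h4 y hy m
    · intro s hs y hy m
      have := h5 s hs y hy m
      exact this
    · intro s hs
      have := h7 s hs
      rwa [hcard] at this
    · rwa [hcard] at h8
  choose W hW using level
  -- finiteness of the constants
  have hvol : volume (revolve (closure U₁)) + volume (revolve (closure U₂)) < ⊤ :=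
    ENNReal.add_lt_top.2
      ⟨(Literature.Barriers.NavierStokesRegularity.isCompact_revolve
          hA.structure₁.isCompact_closure).measure_lt_top,
        (Literature.Barriers.NavierStokesRegularity.isCompact_revolve
          hA.structure₂.isCompact_closure).measure_lt_top⟩
  set CE : ℝ≥0∞ := ENNReal.ofReal Λ * (volume (revolve (closure U₁)) + volume (revolve (closure U₂)))
    with hCE
  have hCEtop : CE ≠ ⊤ := ENNReal.mul_ne_top ENNReal.ofReal_ne_top hvol.ne
  set CD : ℝ≥0∞ := CE * ENNReal.ofReal T with hCD
  have hCDtop : CD ≠ ⊤ := ENNReal.mul_ne_top hCEtop ENNReal.ofReal_ne_top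
  refine ⟨θ / 2, δ / 4 / (2 * Λ + 1), hprof, W, ?_⟩
  exact
    { θ_pos := by positivity
      ν₀_pos := by positivity
      h_zero := fun q => by
        simp only [hhprof]
        rw [show hProfile₁ f₁ φ₁ δ κ 0 q = f₁ q from hQ.H_zero 0 q,
          show hProfile₂ v₁ v₂ f₁ φ₁ f₂ φ₂ δ κ 0 q = f₂ q from hQ.H_zero 1 q]
      gain := fun x hx n => by
        have hg := hgainC x hx n
        have hy₂ : meridian (τ • x + cantorTranslate X z M n) ∈ closure U₂ := hA.mapsTo_revolve_closure n hx
        have hy₁ : meridian (τ • x + cantorTranslate X z M n) ∉ closure U₁ :=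
          Set.disjoint_right.1 hA.disjoint_closure hy₂
        have h0 : hprof 0 (meridian x) = f₁ (meridian x) + f₂ (meridian x) := by
          simp only [hhprof]
          rw [show hProfile₁ f₁ φ₁ δ κ 0 (meridian x) = f₁ (meridian x) from hQ.H_zero 0 _,
            show hProfile₂ v₁ v₂ f₁ φ₁ f₂ φ₂ δ κ 0 (meridian x) = f₂ (meridian x) from hQ.H_zero 1 _]
        have hT' : hprof T (meridian (τ • x + cantorTranslate X z M n)) =
            hProfile₂ v₁ v₂ f₁ φ₁ f₂ φ₂ δ κ T (meridian (τ • x + cantorTranslate X z M n)) := by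
          simp only [hhprof]
          rw [show hProfile₁ f₁ φ₁ δ κ T (meridian (τ • x + cantorTranslate X z M n)) = 0 from
            hQ.H_eq_zero 0 T hy₁, zero_add]
        rw [h0, hT']
        linarith
      smooth := fun j => (hW j).1
      divFree := fun j => (hW j).2.1
      tsupport_subset := fun j s hs => (hW j).2.2.1 s hs
      norm_zero := fun j y hy m => by
        have h1 := (hW j).2.2.2.1 y hy m
        rw [show (EuclideanSpace.single 2 1 : EuclideanSpace ℝ (Fin 3)) = eZ from rfl, h1]
        simp only [hhprof]
        rw [show hProfile₁ f₁ φ₁ δ κ 0 (meridian y) = f₁ (meridian y) from hQ.H_zero 0 _,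
          show hProfile₂ v₁ v₂ f₁ φ₁ f₂ φ₂ δ κ 0 (meridian y) = f₂ (meridian y) from hQ.H_zero 1 _]
      abs_sq_sub_lt := fun j s hs y hy m => by
        have h1 := (hW j).2.2.2.2.1 s hs y hy m
        rw [show (EuclideanSpace.single 2 1 : EuclideanSpace ℝ (Fin 3)) = eZ from rfl]
        exact lt_of_le_of_lt h1 (by linarith)
      nsi := fun j => (hW j).2.2.2.2.2.1
      energy := ⟨CE.toNNReal, fun j s hs => by
        rw [ENNReal.coe_toNNReal hCEtop, hCE]
        have := (hW j).2.2.2.2.2.2.1 s hs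
        calc _ ≤ _ := this
          _ = _ := by ring⟩
      dissipation := ⟨CD.toNNReal, fun j => by
        rw [ENNReal.coe_toNNReal hCDtop, hCD, hCE]
        have := (hW j).2.2.2.2.2.2.2
        calc _ ≤ _ := this
          _ = _ := by ring⟩ }

/-- **Fact D′ holds — Proposition 16 (Ożański 2017) / Lemma 5.5 (Scheffer 1987): every geometric
arrangement for Theorem 14 carries level data `IsNSICantorLevelFields`.**
[cite: Ozanski2017NSISingular, §6.2 ((6.8)–(6.12), Prop. 16), §6.3 (Steps 1–3), §6.4 (Thm. 17)]
[cite: Scheffer1987, Lemmas 3.1–3.2 and 5.5] -/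
theorem NSICantorBlock_of_arrangement_holds : NSICantorBlock_of_arrangement :=
  fun _ _ _ _ _ _ _ _ _ _ _ _ _ hA => hA.exists_levelFields

/-- **Fact B′ holds: for every `ξ ∈ (0,1)` there is a Cantor block** (Ożański 2017, §6.2: the
geometric arrangement of §6.5 — fact C′, discharged as `NSICantorArrangementExists_holds` — and
Proposition 16 with the rescaling (6.13)–(6.17); Scheffer 1987, §5).
[cite: Ozanski2017NSISingular, §6.2 p. 28 and Prop. 16] [cite: Scheffer1987, §5 (Lemmas 5.5–5.8)] -/
theorem NSICantorBlockExists_holds : NSICantorBlockExists :=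
  nsiCantorBlockExists_of_block_of_arrangement NSICantorBlock_of_arrangement_holds

/-- **Scheffer's 1987 theorem holds** (`NavierStokesInequalityNearlyOneDimSingularSet`: for every
`ξ ∈ (0,1)` a weak solution of the Navier–Stokes inequality whose singular set has Hausdorff
dimension `≥ ξ`; Scheffer, Comm. Math. Phys. 110 (1987), Theorem of §1; Ożański 2017, Theorem 14),
through the accepted assembly `navierStokesInequalityNearlyOneDimSingularSet_of_block_of_arrangement`
(Cantor switching `NSICantorSwitching_holds`, arrangement `NSICantorArrangementExists_holds`, and
Proposition 16 = `NSICantorBlock_of_arrangement_holds`).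
[cite: Scheffer1987, §1 (Theorem) and p. 551] [cite: Ozanski2017NSISingular, Thm. 14 and §6.2 p. 30] -/
theorem NavierStokesInequalityNearlyOneDimSingularSet_holds : NavierStokesInequalityNearlyOneDimSingularSet :=
  navierStokesInequalityNearlyOneDimSingularSet_of_block_of_arrangement NSICantorBlock_of_arrangement_holds

end Main

end Literature.Barriers.NavierStokesRegularity
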